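import Mathlib
import HarnessLib
import HarnessLib.Audit
import Summits.AtomisticToContinuum.Crystallization.Statement
import Summits.AtomisticToContinuum.Crystallization.Theses.FluxTubeKepler

/-!
# Crux `FloorGivesLayered` (stmt-AtomisticToContinuum-15223) — birth skeleton (BC3)

Route `FluxTubeKepler` (route-AtomisticToContinuum-FluxTubeKepler), sub-problem `Crystallization`;
the item is a hypothesis of the route's deciding theorem `closes` (crux-only gate; informal size M,
"bookkeeping"): for every periodic `P₀`,

  FLOOR   `N·e(P₀) ≤ E(x)` on Lennard-Jones ground states `x`, and
  BUDGET  `∀ R η > 0 ∃ c > 0, c·#{(R, η)-non-layered sites of x} ≤ E(x) − N·e(P₀)` on ground states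

imply, for every SEQUENCE of ground states `x N`, the layered-window hypothesis of
`PeriodicGivenLayered` (item 11779, PROVED): ONE in-layer spacing `a ∈ [47/50, 1]` such that for all
`R` and all `ε > 0`, frequently in `N`, some translate `x N · + t` is two-way `ε`-matched on `B(0, R)`
with a layered set `A{k·u(a) + l·v(a) + L_s(m)·w(a) + z(m)·e₃}` (`s` a Hägg word, layer heights `z`
with increments in `[39a/50, 17a/20]`, `A` a linear isometry).

## The line — two named stubs, cut at the change of quantifier order

* `stub_eventuallyGoodSite` — ENERGY ⇒ GOOD SITES (the `o(N)` half). For every `P₀` satisfying FLOOR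
  and BUDGET and every scale `R, η > 0`: for all large `N`, EVERY Lennard-Jones ground state of `N`
  particles has at least one `(R, η)`-layered-good site `i` (the negation of the predicate counted in
  BUDGET: the relative pattern `{x j − x i}` is two-way `η`-matched on `B(0, R)` with a layered set of
  SOME spacing `a_N ∈ [47/50, 1]`). Content: FLOOR + ground states exist (`LennardJonesGroundStatesExist_holds`)
  + `crysEnergyLimit` (`E(N)/N → e* = ⨅_Q e(Q)`, Theorems/ChargedEnergyGap/Negative/Unconditional) +
  `eStar_le` force `e(P₀) = e*`, hence `E(N) − N·e(P₀) = o(N)`; with the `c` of BUDGET,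
  `c·#bad ≤ o(N) < c·N` for `N` large, so `#bad < N` and a good site exists. Size M⁻.
* `stub_spacingSelection` — ONE SPACING FOR ALL SCALES (the selection half; pure analysis, no
  energies, no ground states). For ANY sequence of finite configurations: good sites frequently in `N`
  at every scale `(R, η)`, with scale- and `N`-dependent spacings `a ∈ [47/50, 1]`, imply ONE spacing
  `a* ∈ [47/50, 1]` with good sites at spacing exactly `a*`, frequently in `N`, at every scale `(R, ε)`.
  Content: diagonal over `(R_k, η_k) = (k + 2, 1/(k+1))`, Bolzano–Weierstrass on `Icc (47/50) 1`, and
  the DILATION COVARIANCE of the layered family — `u(a), v(a), w(a)` are linear in `a`, so with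
  `z ↦ (a*/a)·z` (which keeps the increments in the `a*`-box) the layered set of spacing `a*` is the
  `(a*/a)`-dilate of that of spacing `a`; points of norm `≤ R + 1` move by `≤ (50/47)(R + 1)|a − a*|`,
  absorbed by `η_k + (50/47)(R + 1)|a_k − a*| ≤ ε` and by reading the `a`-window at radius
  `R_k ≥ (50/47)R + 1` (the "R ↦ R − 1, ε ↦ 2ε" of the item's why-might-fail; the grounder's caution
  "rescale z too" is built into the statement's free `z`). Size M.
* `FloorGivesLayered_of` — the kernel-checked composition (real proof, no `sorry`):
  `Stmt.stub_eventuallyGoodSite → Stmt.stub_spacingSelection → FluxTubeKepler.FloorGivesLayered`, the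
  crux BY NAME from the two stub STATEMENTS by name (`Stmt.<stub>` is the registered signature of
  `<stub>` as a named `Prop`, definitionally equal — see the two `example`s): feed stub 1
  (specialised to the sequence, `Eventually.frequently`) into stub 2, take its `a`, and for a target
  `(R, ε)` read the fixed-spacing good site at radius `max R 1` and translate by `t := −x N i`
  (`x N j + t = x N j − x N i`); radius monotonicity handles `R ≤ 0`.
* `FloorGivesLayered_proof : FluxTubeKepler.FloorGivesLayered` — the crux by name from the two stubs
  (the only `sorry`s in its cone are `stub_eventuallyGoodSite`, `stub_spacingSelection`).

SPELLING NOTE (for provers): inside the stub signatures the crux's matching clause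
`let S : Set _ := {layered set}; (∀ p ∈ S, …) ∧ (∀ j, … ∃ p ∈ S, …)` is written as the β-redex
`(fun S : Set _ => (∀ p ∈ S, …) ∧ (∀ j, … ∃ p ∈ S, …)) {layered set}` — the same term up to ζ/β-reduction
(the composition below passes the crux's `let`-spelled hypotheses to the stubs with no rewriting), chosen
so that the registered signature text contains no `:=` (the stub scanner of `ledger skeleton check` reads
the first `:=` of a declaration as the start of its body). In a proof, `intro`/`obtain` see through it;
`beta_reduce` or `simp only []` displays it reduced.

`sorry` occurs ONLY inside the two `stub_*` theorems. Neither stub is the crux or the sub-problem in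
disguise: stub 1 lacks the selection of one `a` (its spacings vary with `N` and the scale), stub 2 lacks
all energetics (BC3 probes `stub → FloorGivesLayered`, `stub → Crystallization` by
`first | exact? | simpa | aesop` FAIL — see `Lines/birth.md`).

Disproof used: none on file (`ledger crux ls stmt-AtomisticToContinuum-15223`: no workfiles, no
`Disproof.lean`, no Negative lemmas, 2026-08-17). Grounder g44-1 / refuter rreview-0816T14 notes on the
item (derivation, "rescale z", "use radius R+1") are honoured by the cut and by stub 2's statement.
-/

namespace Summit.AtomisticToContinuum.Crystallization.Cruxes.FloorGivesLayered.Birth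

open Filter

/-! ## The two stub statements as named `Prop`s (`Stmt.<stub>` = the registered signature of `<stub>`) -/

/-- **Statement of stub 1 — ENERGY ⇒ GOOD SITES.** For every periodic `P₀` with the energy FLOOR
and the defect BUDGET of the crux, and every scale `R, η > 0`: eventually in `N`, every Lennard-Jones
ground state of `N` particles in `ℝ³` has a site `i` whose relative pattern `{x j − x i}` is two-way
`η`-matched on `B(0, R)` with a layered set of some spacing `a ∈ [47/50, 1]` (the predicate whose
failure set BUDGET counts). -/
def Stmt.stub_eventuallyGoodSite : Prop :=
  ∀ P₀ : Literature.MathematicalPhysics.StatisticalMechanics.PeriodicConfiguration 3, (∀ (N : ℕ) (x : Fin N → EuclideanSpace ℝ (Fin 3)), Literature.MathematicalPhysics.StatisticalMechanics.IsGroundState Literature.MathematicalPhysics.StatisticalMechanics.lennardJones x → (N : ℝ) * P₀.energyPerParticle Literature.MathematicalPhysics.StatisticalMechanics.lennardJones ≤ Literature.MathematicalPhysics.StatisticalMechanics.interactionEnergy Literature.MathematicalPhysics.StatisticalMechanics.lennardJones x) → (∀ R η : ℝ, 0 < R → 0 < η → ∃ c : ℝ, 0 < c ∧ ∀ (N : ℕ)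 (x : Fin N → EuclideanSpace ℝ (Fin 3)), Literature.MathematicalPhysics.StatisticalMechanics.IsGroundState Literature.MathematicalPhysics.StatisticalMechanics.lennardJones x → c * (Nat.card {i : Fin N // ¬ ∃ a : ℝ, 47 / 50 ≤ a ∧ a ≤ 1 ∧ ∃ (A : EuclideanSpace ℝ (Fin 3) →ₗᵢ[ℝ] EuclideanSpace ℝ (Fin 3)) (s : ℤ → ℤ) (z : ℤ → ℝ), Literature.MathematicalPhysics.StatisticalMechanics.IsHaggSeq s ∧ (∀ m : ℤ, 39 / 50 * a ≤ z (m + 1) - z m ∧ z (m + 1) - z m ≤ 17 / 20 * a) ∧ (fun S : Set (EuclideanSpace ℝ (Fin 3)) => (∀ p ∈ S, ‖p‖ ≤ R → ∃ j : Fin N, dist (x j - x i) p ≤ η) ∧ (∀ j : Fin N, ‖x j - x i‖ ≤ R → ∃ p ∈ S, dist (x j - x i) p ≤ η)) {p | ∃ m k l : ℤ, p = A (((k : ℝ) • Literature.MathematicalPhysics.StatisticalMechanics.triangularVec₁ a) + ((l : ℝ) • Literature.MathematicalPhysics.StatisticalMechanics.triangularVec₂ a) + ((Literature.MathematicalPhysics.StatisticalMechanics.haggLabel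 s m : ℝ) • Literature.MathematicalPhysics.StatisticalMechanics.barlowOffset a) + (z m • Literature.MathematicalPhysics.StatisticalMechanics.layerNormal 1))}} : ℝ) ≤ Literature.MathematicalPhysics.StatisticalMechanics.interactionEnergy Literature.MathematicalPhysics.StatisticalMechanics.lennardJones x - (N : ℝ) * P₀.energyPerParticle Literature.MathematicalPhysics.StatisticalMechanics.lennardJones) → ∀ R η : ℝ, 0 < R → 0 < η → ∀ᶠ N in Filter.atTop, ∀ x : Fin N → EuclideanSpace ℝ (Fin 3), Literature.MathematicalPhysics.StatisticalMechanics.IsGroundState Literature.MathematicalPhysics.StatisticalMechanics.lennardJones x → ∃ i : Fin N, ∃ a : ℝ, 47 / 50 ≤ a ∧ a ≤ 1 ∧ ∃ (A : EuclideanSpace ℝ (Fin 3) →ₗᵢ[ℝ] EuclideanSpace ℝ (Fin 3)) (s : ℤ → ℤ) (z : ℤ → ℝ), Literature.MathematicalPhysics.StatisticalMechanics.IsHaggSeq s ∧ (∀ m : ℤ, 39 / 50 * a ≤ z (m + 1) - z m ∧ z (m + 1) - z m ≤ 17 / 20 * a) ∧ (fun S : Set (EuclideanSpace ℝ (Fin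 3)) => (∀ p ∈ S, ‖p‖ ≤ R → ∃ j : Fin N, dist (x j - x i) p ≤ η) ∧ (∀ j : Fin N, ‖x j - x i‖ ≤ R → ∃ p ∈ S, dist (x j - x i) p ≤ η)) {p | ∃ m k l : ℤ, p = A (((k : ℝ) • Literature.MathematicalPhysics.StatisticalMechanics.triangularVec₁ a) + ((l : ℝ) • Literature.MathematicalPhysics.StatisticalMechanics.triangularVec₂ a) + ((Literature.MathematicalPhysics.StatisticalMechanics.haggLabel s m : ℝ) • Literature.MathematicalPhysics.StatisticalMechanics.barlowOffset a) + (z m • Literature.MathematicalPhysics.StatisticalMechanics.layerNormal 1))}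

/-- **Statement of stub 2 — ONE SPACING FOR ALL SCALES.** For every sequence of finite
configurations `x N` in `ℝ³`: if at every scale `R, η > 0`, frequently in `N`, some site of `x N` is
layered-good with SOME spacing `a ∈ [47/50, 1]` (depending on the scale and on `N`), then there is ONE
spacing `a ∈ [47/50, 1]` such that at every scale `R, ε > 0`, frequently in `N`, some site of `x N` is
layered-good with spacing exactly `a`. -/
def Stmt.stub_spacingSelection : Prop :=
  ∀ x : (N : ℕ) → (Fin N → EuclideanSpace ℝ (Fin 3)), (∀ R η : ℝ, 0 < R → 0 < η → ∃ᶠ N in Filter.atTop, ∃ i : Fin N, ∃ a : ℝ, 47 / 50 ≤ a ∧ a ≤ 1 ∧ ∃ (A : EuclideanSpace ℝ (Fin 3) →ₗᵢ[ℝ] EuclideanSpace ℝ (Fin 3)) (s : ℤ → ℤ) (z : ℤ → ℝ), Literature.MathematicalPhysics.StatisticalMechanics.IsHaggSeq s ∧ (∀ m : ℤ, 39 / 50 * a ≤ z (m + 1) - z m ∧ z (m + 1) - z m ≤ 17 / 20 * a) ∧ (fun S : Set (EuclideanSpace ℝ (Fin 3)) => (∀ p ∈ S, ‖p‖ ≤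 R → ∃ j : Fin N, dist (x N j - x N i) p ≤ η) ∧ (∀ j : Fin N, ‖x N j - x N i‖ ≤ R → ∃ p ∈ S, dist (x N j - x N i) p ≤ η)) {p | ∃ m k l : ℤ, p = A (((k : ℝ) • Literature.MathematicalPhysics.StatisticalMechanics.triangularVec₁ a) + ((l : ℝ) • Literature.MathematicalPhysics.StatisticalMechanics.triangularVec₂ a) + ((Literature.MathematicalPhysics.StatisticalMechanics.haggLabel s m : ℝ) • Literature.MathematicalPhysics.StatisticalMechanics.barlowOffset a) + (z m • Literature.MathematicalPhysics.StatisticalMechanics.layerNormal 1))}) → ∃ a : ℝ, 47 / 50 ≤ a ∧ a ≤ 1 ∧ ∀ R ε : ℝ, 0 < R → 0 < ε → ∃ᶠ N in Filter.atTop, ∃ i : Fin N, ∃ (A : EuclideanSpace ℝ (Fin 3) →ₗᵢ[ℝ] EuclideanSpace ℝ (Fin 3)) (s : ℤ → ℤ) (z : ℤ → ℝ), Literature.MathematicalPhysics.StatisticalMechanics.IsHaggSeq s ∧ (∀ m : ℤ, 39 / 50 * a ≤ z (m + 1) - z m ∧ z (m + 1) - z m ≤ 17 / 20 * a) ∧ (fun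 S : Set (EuclideanSpace ℝ (Fin 3)) => (∀ p ∈ S, ‖p‖ ≤ R → ∃ j : Fin N, dist (x N j - x N i) p ≤ ε) ∧ (∀ j : Fin N, ‖x N j - x N i‖ ≤ R → ∃ p ∈ S, dist (x N j - x N i) p ≤ ε)) {p | ∃ m k l : ℤ, p = A (((k : ℝ) • Literature.MathematicalPhysics.StatisticalMechanics.triangularVec₁ a) + ((l : ℝ) • Literature.MathematicalPhysics.StatisticalMechanics.triangularVec₂ a) + ((Literature.MathematicalPhysics.StatisticalMechanics.haggLabel s m : ℝ) • Literature.MathematicalPhysics.StatisticalMechanics.barlowOffset a) + (z m • Literature.MathematicalPhysics.StatisticalMechanics.layerNormal 1))}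

/-! ## The stubs (registered signatures inlined verbatim; `sorry` lives only here) -/

/-- **Stub 1 — ENERGY ⇒ GOOD SITES** (signature = `Stmt.stub_eventuallyGoodSite`, inlined). Why plausibly
true: FLOOR at the ground states that exist for every `N` (`LennardJonesGroundStatesExist_holds`) gives
`e(P₀) ≤ E(N)/N`; `crysEnergyLimit` gives `E(N)/N → e* = ⨅_Q e(Q)` and `eStar_le` gives
`e* ≤ e(P₀)`, so `e(P₀) = e*` and `E(N) − N·e(P₀) = o(N)`; a ground state `x` of `N` particles has
`E(x) = E(N)` (definition of `IsGroundState`), so BUDGET's `c > 0` gives `c·#bad(x) ≤ o(N) < c·N`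
for `N ≥ N₀(R, η)`, i.e. `#bad(x) < N = #sites`: some site is good. Size M⁻ (provable now from
in-tree facts). Leans on: `ChargedEnergyGapNegative.crysEnergyLimit`, `….eStar_le`,
`….eStar_le_groundStateEnergy_div`, `LennardJonesGroundStatesExist_holds`, `Nat.card`/`Finset`
counting in `Fin N`. -/
theorem stub_eventuallyGoodSite : ∀ P₀ : Literature.MathematicalPhysics.StatisticalMechanics.PeriodicConfiguration 3, (∀ (N : ℕ) (x : Fin N → EuclideanSpace ℝ (Fin 3)), Literature.MathematicalPhysics.StatisticalMechanics.IsGroundState Literature.MathematicalPhysics.StatisticalMechanics.lennardJones x → (N : ℝ) * P₀.energyPerParticle Literature.MathematicalPhysics.StatisticalMechanics.lennardJones ≤ Literature.MathematicalPhysics.StatisticalMechanics.interactionEnergy Literature.MathematicalPhysics.StatisticalMechanics.lennardJones x) → (∀ R η : ℝ, 0 < R → 0 < η → ∃ c : ℝ, 0 < c ∧ ∀ (N : ℕ) (x : Fin N → EuclideanSpace ℝ (Fin 3)), Literature.MathematicalPhysics.StatisticalMechanics.IsGroundState Literature.MathematicalPhysics.StatisticalMechanics.lennardJones x → c * (Nat.card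 {i : Fin N // ¬ ∃ a : ℝ, 47 / 50 ≤ a ∧ a ≤ 1 ∧ ∃ (A : EuclideanSpace ℝ (Fin 3) →ₗᵢ[ℝ] EuclideanSpace ℝ (Fin 3)) (s : ℤ → ℤ) (z : ℤ → ℝ), Literature.MathematicalPhysics.StatisticalMechanics.IsHaggSeq s ∧ (∀ m : ℤ, 39 / 50 * a ≤ z (m + 1) - z m ∧ z (m + 1) - z m ≤ 17 / 20 * a) ∧ (fun S : Set (EuclideanSpace ℝ (Fin 3)) => (∀ p ∈ S, ‖p‖ ≤ R → ∃ j : Fin N, dist (x j - x i) p ≤ η) ∧ (∀ j : Fin N, ‖x j - x i‖ ≤ R → ∃ p ∈ S, dist (x j - x i) p ≤ η)) {p | ∃ m k l : ℤ, p = A (((k : ℝ) • Literature.MathematicalPhysics.StatisticalMechanics.triangularVec₁ a) + ((l : ℝ) • Literature.MathematicalPhysics.StatisticalMechanics.triangularVec₂ a) + ((Literature.MathematicalPhysics.StatisticalMechanics.haggLabel s m : ℝ) • Literature.MathematicalPhysics.StatisticalMechanics.barlowOffset a) + (z m • Literature.MathematicalPhysics.StatisticalMechanics.layerNormal 1))}}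 : ℝ) ≤ Literature.MathematicalPhysics.StatisticalMechanics.interactionEnergy Literature.MathematicalPhysics.StatisticalMechanics.lennardJones x - (N : ℝ) * P₀.energyPerParticle Literature.MathematicalPhysics.StatisticalMechanics.lennardJones) → ∀ R η : ℝ, 0 < R → 0 < η → ∀ᶠ N in Filter.atTop, ∀ x : Fin N → EuclideanSpace ℝ (Fin 3), Literature.MathematicalPhysics.StatisticalMechanics.IsGroundState Literature.MathematicalPhysics.StatisticalMechanics.lennardJones x → ∃ i : Fin N, ∃ a : ℝ, 47 / 50 ≤ a ∧ a ≤ 1 ∧ ∃ (A : EuclideanSpace ℝ (Fin 3) →ₗᵢ[ℝ] EuclideanSpace ℝ (Fin 3)) (s : ℤ → ℤ) (z : ℤ → ℝ), Literature.MathematicalPhysics.StatisticalMechanics.IsHaggSeq s ∧ (∀ m : ℤ, 39 / 50 * a ≤ z (m + 1) - z m ∧ z (m + 1) - z m ≤ 17 / 20 * a) ∧ (fun S : Set (EuclideanSpace ℝ (Fin 3)) => (∀ p ∈ S, ‖p‖ ≤ R → ∃ j : Fin N, dist (x j - x i) p ≤ η) ∧ (∀ j : Fin N, ‖x j - x i‖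 ≤ R → ∃ p ∈ S, dist (x j - x i) p ≤ η)) {p | ∃ m k l : ℤ, p = A (((k : ℝ) • Literature.MathematicalPhysics.StatisticalMechanics.triangularVec₁ a) + ((l : ℝ) • Literature.MathematicalPhysics.StatisticalMechanics.triangularVec₂ a) + ((Literature.MathematicalPhysics.StatisticalMechanics.haggLabel s m : ℝ) • Literature.MathematicalPhysics.StatisticalMechanics.barlowOffset a) + (z m • Literature.MathematicalPhysics.StatisticalMechanics.layerNormal 1))} := by
  sorry

/-- **Stub 2 — ONE SPACING FOR ALL SCALES** (signature = `Stmt.stub_spacingSelection`, inlined). Why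
plausibly true: choose scales `(R_k, η_k) := (k + 2, 1/(k + 1))` and, by the hypothesis, indices
`N_k ≥ k` carrying a good site `i_k` with spacing `a_k ∈ [47/50, 1]` and data `(A_k, s_k, z_k)`;
Bolzano–Weierstrass on `Icc (47/50) 1` (`IsCompact.tendsto_subseq`) gives `a_{φ k} → a*`. DILATION
COVARIANCE: `triangularVec₁ a = a • !₂[1,0,0]`, `triangularVec₂ a`, `barlowOffset a` are linear in `a`
and `layerNormal 1` is fixed, so with `z' := (a*/a_k) • z_k` (increments stay in
`[39a*/50, 17a*/20]`) the layered set `S(a*, A_k, s_k, z')` is the `(a*/a_k)`-dilate of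
`S(a_k, A_k, s_k, z_k)`; a point of norm `≤ R + 1` moves by `≤ (50/47)(R + 1)|a_k − a*|`. Given a
target `(R, ε)` and a threshold `M`, take `k` with `φ k ≥ M`, `R_{φ k} ≥ (50/47)R + 1`,
`η_{φ k} ≤ ε/2`, `(50/47)²(R + 1)|a_{φ k} − a*| ≤ ε/2`: the `(R_{φ k}, η_{φ k})`-match at spacing
`a_{φ k}` is an `(R, ε)`-match at spacing `a*` for the same site, chart `A` and word `s`. No energies,
no minimal distance needed. Size M. Leans on: `IsCompact.tendsto_subseq` / `tendsto_subseq_of_bounded`,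
`Filter.frequently_atTop`, `EuclideanSpace` coordinates (`!₂[…]`, `PiLp`), `LinearIsometry.map_smul`,
`norm_smul`, `dist_triangle`. -/
theorem stub_spacingSelection : ∀ x : (N : ℕ) → (Fin N → EuclideanSpace ℝ (Fin 3)), (∀ R η : ℝ, 0 < R → 0 < η → ∃ᶠ N in Filter.atTop, ∃ i : Fin N, ∃ a : ℝ, 47 / 50 ≤ a ∧ a ≤ 1 ∧ ∃ (A : EuclideanSpace ℝ (Fin 3) →ₗᵢ[ℝ] EuclideanSpace ℝ (Fin 3)) (s : ℤ → ℤ) (z : ℤ → ℝ), Literature.MathematicalPhysics.StatisticalMechanics.IsHaggSeq s ∧ (∀ m : ℤ, 39 / 50 * a ≤ z (m + 1) - z m ∧ z (m + 1) - z m ≤ 17 / 20 * a) ∧ (fun S : Set (EuclideanSpace ℝ (Fin 3)) => (∀ p ∈ S, ‖p‖ ≤ R → ∃ j : Fin N, dist (x N j - x N i) p ≤ η) ∧ (∀ j : Fin N, ‖x N j - x N i‖ ≤ R → ∃ p ∈ S, dist (x N j - x N i) p ≤ η)) {p | ∃ m k l : ℤ, p = A (((k : ℝ) • Literature.MathematicalPhysics.StatisticalMechanics.triangularVec₁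 a) + ((l : ℝ) • Literature.MathematicalPhysics.StatisticalMechanics.triangularVec₂ a) + ((Literature.MathematicalPhysics.StatisticalMechanics.haggLabel s m : ℝ) • Literature.MathematicalPhysics.StatisticalMechanics.barlowOffset a) + (z m • Literature.MathematicalPhysics.StatisticalMechanics.layerNormal 1))}) → ∃ a : ℝ, 47 / 50 ≤ a ∧ a ≤ 1 ∧ ∀ R ε : ℝ, 0 < R → 0 < ε → ∃ᶠ N in Filter.atTop, ∃ i : Fin N, ∃ (A : EuclideanSpace ℝ (Fin 3) →ₗᵢ[ℝ] EuclideanSpace ℝ (Fin 3)) (s : ℤ → ℤ) (z : ℤ → ℝ), Literature.MathematicalPhysics.StatisticalMechanics.IsHaggSeq s ∧ (∀ m : ℤ, 39 / 50 * a ≤ z (m + 1) - z m ∧ z (m + 1) - z m ≤ 17 / 20 * a) ∧ (fun S : Set (EuclideanSpace ℝ (Fin 3)) => (∀ p ∈ S, ‖p‖ ≤ R → ∃ j : Fin N, dist (x N j - x N i) p ≤ ε) ∧ (∀ j : Fin N, ‖x N j - x N i‖ ≤ R → ∃ p ∈ S, dist (x N j - x N i) p ≤ ε)) {p | ∃ m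 k l : ℤ, p = A (((k : ℝ) • Literature.MathematicalPhysics.StatisticalMechanics.triangularVec₁ a) + ((l : ℝ) • Literature.MathematicalPhysics.StatisticalMechanics.triangularVec₂ a) + ((Literature.MathematicalPhysics.StatisticalMechanics.haggLabel s m : ℝ) • Literature.MathematicalPhysics.StatisticalMechanics.barlowOffset a) + (z m • Literature.MathematicalPhysics.StatisticalMechanics.layerNormal 1))} := by
  sorry

/-! ## The composition (kernel-checked, no sorry) -/

/-- **Composition** `Stmt.stub_eventuallyGoodSite → Stmt.stub_spacingSelection →
FluxTubeKepler.FloorGivesLayered` (the crux BY NAME; the two hypotheses are the stub statements by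
name, definitionally the registered signatures): real proof — specialise stub 1 to the ground-state sequence (eventually ⇒ frequently),
select the spacing `a` by stub 2, and for a target `(R, ε)` read the fixed-spacing good site `i` of
`x N` at radius `max R 1`, translating by `t := −x N i`. -/
theorem FloorGivesLayered_of : Stmt.stub_eventuallyGoodSite → Stmt.stub_spacingSelection → Summit.AtomisticToContinuum.Crystallization.Theses.FluxTubeKepler.FloorGivesLayered := by
  intro h1 h2 P₀ hE hD x hx
  -- stub 1, specialised to the sequence: good sites at every scale, eventually (hence frequently) in N
  have hgood := fun (R η : ℝ) (hR : 0 < R) (hη : 0 < η) =>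
    ((h1 P₀ hE hD R η hR hη).mono fun N hN => hN (x N) (hx N)).frequently
  -- stub 2: one spacing for all scales
  obtain ⟨a, ha₁, ha₂, hwin⟩ := h2 x hgood
  refine ⟨a, ha₁, ha₂, fun R ε hε => ?_⟩
  have hR' : 0 < max R 1 := lt_max_of_lt_right one_pos
  refine (hwin (max R 1) ε hR' hε).mono fun N hN => ?_
  obtain ⟨i, A, s, z, hs, hbox, hM⟩ := hN
  refine ⟨A, -x N i, s, z, hs, hbox, ?_⟩
  have hsub : ∀ j : Fin N, x N j + -x N i = x N j - x N i := fun j =>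
    (sub_eq_add_neg (x N j) (x N i)).symm
  obtain ⟨hM₁, hM₂⟩ := hM
  intro S
  refine ⟨fun p hp hpR => ?_, fun j hj => ?_⟩
  · obtain ⟨j, hj⟩ := hM₁ p hp (hpR.trans (le_max_left R 1))
    exact ⟨j, by rw [hsub j]; exact hj⟩
  · rw [hsub j] at hj ⊢
    exact hM₂ j (hj.trans (le_max_left R 1))

/-- **The crux BY NAME from the two stubs** (type literally the route decl; the only `sorry`s in its
cone are `stub_eventuallyGoodSite` and `stub_spacingSelection`). -/
theorem FloorGivesLayered_proof : Summit.AtomisticToContinuum.Crystallization.Theses.FluxTubeKepler.FloorGivesLayered :=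
  FloorGivesLayered_of stub_eventuallyGoodSite stub_spacingSelection

/-- Literal BC3 shape, kernel-checked: the composition with the two registered stub SIGNATURES inlined
as hypotheses (certifies that `Stmt.stub_eventuallyGoodSite` / `Stmt.stub_spacingSelection` are
definitionally the registered signatures of `stub_eventuallyGoodSite` / `stub_spacingSelection`). -/
example : (∀ P₀ : Literature.MathematicalPhysics.StatisticalMechanics.PeriodicConfiguration 3, (∀ (N : ℕ) (x : Fin N → EuclideanSpace ℝ (Fin 3)), Literature.MathematicalPhysics.StatisticalMechanics.IsGroundState Literature.MathematicalPhysics.StatisticalMechanics.lennardJones x → (N : ℝ) * P₀.energyPerParticle Literature.MathematicalPhysics.StatisticalMechanics.lennardJones ≤ Literature.MathematicalPhysics.StatisticalMechanics.interactionEnergy Literature.MathematicalPhysics.StatisticalMechanics.lennardJones x) → (∀ R η : ℝ, 0 < R → 0 < η → ∃ c : ℝ, 0 < c ∧ ∀ (N : ℕ) (x : Fin N → EuclideanSpace ℝ (Fin 3)), Literature.MathematicalPhysics.StatisticalMechanics.IsGroundState Literature.MathematicalPhysics.StatisticalMechanics.lennardJones x → c * (Nat.card {i : Fin N // ¬ ∃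 a : ℝ, 47 / 50 ≤ a ∧ a ≤ 1 ∧ ∃ (A : EuclideanSpace ℝ (Fin 3) →ₗᵢ[ℝ] EuclideanSpace ℝ (Fin 3)) (s : ℤ → ℤ) (z : ℤ → ℝ), Literature.MathematicalPhysics.StatisticalMechanics.IsHaggSeq s ∧ (∀ m : ℤ, 39 / 50 * a ≤ z (m + 1) - z m ∧ z (m + 1) - z m ≤ 17 / 20 * a) ∧ (fun S : Set (EuclideanSpace ℝ (Fin 3)) => (∀ p ∈ S, ‖p‖ ≤ R → ∃ j : Fin N, dist (x j - x i) p ≤ η) ∧ (∀ j : Fin N, ‖x j - x i‖ ≤ R → ∃ p ∈ S, dist (x j - x i) p ≤ η)) {p | ∃ m k l : ℤ, p = A (((k : ℝ) • Literature.MathematicalPhysics.StatisticalMechanics.triangularVec₁ a) + ((l : ℝ) • Literature.MathematicalPhysics.StatisticalMechanics.triangularVec₂ a) + ((Literature.MathematicalPhysics.StatisticalMechanics.haggLabel s m : ℝ) • Literature.MathematicalPhysics.StatisticalMechanics.barlowOffset a) + (z m • Literature.MathematicalPhysics.StatisticalMechanics.layerNormal 1))}} : ℝ) ≤ Literature.MathematicalPhysics.StatisticalMechanics.interactionEnergy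 Literature.MathematicalPhysics.StatisticalMechanics.lennardJones x - (N : ℝ) * P₀.energyPerParticle Literature.MathematicalPhysics.StatisticalMechanics.lennardJones) → ∀ R η : ℝ, 0 < R → 0 < η → ∀ᶠ N in Filter.atTop, ∀ x : Fin N → EuclideanSpace ℝ (Fin 3), Literature.MathematicalPhysics.StatisticalMechanics.IsGroundState Literature.MathematicalPhysics.StatisticalMechanics.lennardJones x → ∃ i : Fin N, ∃ a : ℝ, 47 / 50 ≤ a ∧ a ≤ 1 ∧ ∃ (A : EuclideanSpace ℝ (Fin 3) →ₗᵢ[ℝ] EuclideanSpace ℝ (Fin 3)) (s : ℤ → ℤ) (z : ℤ → ℝ), Literature.MathematicalPhysics.StatisticalMechanics.IsHaggSeq s ∧ (∀ m : ℤ, 39 / 50 * a ≤ z (m + 1) - z m ∧ z (m + 1) - z m ≤ 17 / 20 * a) ∧ (fun S : Set (EuclideanSpace ℝ (Fin 3)) => (∀ p ∈ S, ‖p‖ ≤ R → ∃ j : Fin N, dist (x j - x i) p ≤ η) ∧ (∀ j : Fin N, ‖x j - x i‖ ≤ R → ∃ p ∈ S, dist (x j - x i) p ≤ η)) {p | ∃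 m k l : ℤ, p = A (((k : ℝ) • Literature.MathematicalPhysics.StatisticalMechanics.triangularVec₁ a) + ((l : ℝ) • Literature.MathematicalPhysics.StatisticalMechanics.triangularVec₂ a) + ((Literature.MathematicalPhysics.StatisticalMechanics.haggLabel s m : ℝ) • Literature.MathematicalPhysics.StatisticalMechanics.barlowOffset a) + (z m • Literature.MathematicalPhysics.StatisticalMechanics.layerNormal 1))}) → (∀ x : (N : ℕ) → (Fin N → EuclideanSpace ℝ (Fin 3)), (∀ R η : ℝ, 0 < R → 0 < η → ∃ᶠ N in Filter.atTop, ∃ i : Fin N, ∃ a : ℝ, 47 / 50 ≤ a ∧ a ≤ 1 ∧ ∃ (A : EuclideanSpace ℝ (Fin 3) →ₗᵢ[ℝ] EuclideanSpace ℝ (Fin 3)) (s : ℤ → ℤ) (z : ℤ → ℝ), Literature.MathematicalPhysics.StatisticalMechanics.IsHaggSeq s ∧ (∀ m : ℤ, 39 / 50 * a ≤ z (m + 1) - z m ∧ z (m + 1) - z m ≤ 17 / 20 * a) ∧ (fun S : Set (EuclideanSpace ℝ (Fin 3)) => (∀ p ∈ S, ‖p‖ ≤ R → ∃ j : Fin N,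 dist (x N j - x N i) p ≤ η) ∧ (∀ j : Fin N, ‖x N j - x N i‖ ≤ R → ∃ p ∈ S, dist (x N j - x N i) p ≤ η)) {p | ∃ m k l : ℤ, p = A (((k : ℝ) • Literature.MathematicalPhysics.StatisticalMechanics.triangularVec₁ a) + ((l : ℝ) • Literature.MathematicalPhysics.StatisticalMechanics.triangularVec₂ a) + ((Literature.MathematicalPhysics.StatisticalMechanics.haggLabel s m : ℝ) • Literature.MathematicalPhysics.StatisticalMechanics.barlowOffset a) + (z m • Literature.MathematicalPhysics.StatisticalMechanics.layerNormal 1))}) → ∃ a : ℝ, 47 / 50 ≤ a ∧ a ≤ 1 ∧ ∀ R ε : ℝ, 0 < R → 0 < ε → ∃ᶠ N in Filter.atTop, ∃ i : Fin N, ∃ (A : EuclideanSpace ℝ (Fin 3) →ₗᵢ[ℝ] EuclideanSpace ℝ (Fin 3)) (s : ℤ → ℤ) (z : ℤ → ℝ), Literature.MathematicalPhysics.StatisticalMechanics.IsHaggSeq s ∧ (∀ m : ℤ, 39 / 50 * a ≤ z (m + 1) - z m ∧ z (m + 1) - z m ≤ 17 / 20 * a) ∧ (fun S : Set (EuclideanSpace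 ℝ (Fin 3)) => (∀ p ∈ S, ‖p‖ ≤ R → ∃ j : Fin N, dist (x N j - x N i) p ≤ ε) ∧ (∀ j : Fin N, ‖x N j - x N i‖ ≤ R → ∃ p ∈ S, dist (x N j - x N i) p ≤ ε)) {p | ∃ m k l : ℤ, p = A (((k : ℝ) • Literature.MathematicalPhysics.StatisticalMechanics.triangularVec₁ a) + ((l : ℝ) • Literature.MathematicalPhysics.StatisticalMechanics.triangularVec₂ a) + ((Literature.MathematicalPhysics.StatisticalMechanics.haggLabel s m : ℝ) • Literature.MathematicalPhysics.StatisticalMechanics.barlowOffset a) + (z m • Literature.MathematicalPhysics.StatisticalMechanics.layerNormal 1))}) → Summit.AtomisticToContinuum.Crystallization.Theses.FluxTubeKepler.FloorGivesLayered :=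
  fun h1 h2 => FloorGivesLayered_of h1 h2

/-- The registered stubs inhabit the named statements (definitional unfolding, both directions). -/
example : Stmt.stub_eventuallyGoodSite ∧ Stmt.stub_spacingSelection :=
  ⟨stub_eventuallyGoodSite, stub_spacingSelection⟩

end Summit.AtomisticToContinuum.Crystallization.Cruxes.FloorGivesLayered.Birth
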